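import Mathlib
import Literature.GroupTheory.CombinatorialGroupTheory.SignedHurwitzAction
import Literature.GroupTheory.CombinatorialGroupTheory.SignedHurwitzStabilisation
import Literature.GroupTheory.CombinatorialGroupTheory.SignedHurwitzExchange
import HarnessLib
import Summits.SmoothPoincare4.SmoothPoincare4.Theorems.ConvexBisectionAcyclicBisectionRigidityStubMatsumotoNormalFormAux
import Summits.SmoothPoincare4.SmoothPoincare4.Theorems.ConvexBisectionAcyclicBisectionRigidityStubMatsumotoNormalFormAux5

/-!
# Matsumoto's normal form for four-letter genus-one words (stub D-alg, corrected form)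

Helper file for stub D-alg (`stub_matsumotoNormalForm`) of line `folded-curve-branch-locus` of the
crux `ConvexBisection.AcyclicBisectionRigidity` (item stmt-SmoothPoincare4-10507).

**Theorem (`helper_matsumotoNormalForm_pm`).**  An integral signed word of four letters at genus one
(`IntWord 1`: classes in `H₁(F_{1,1};ℤ) = ℤ²`, pairing `stdSymp ℤ 1`) with two letters of each sign,
PRIMITIVE classes and trivial signed monodromy `wordProduct = 1` lies in the signed Hurwitz orbit
(`SignedHurwitz.HurwitzOrbit`: braid moves, both alternatives, signs travelling with the letters)
of a word `[(u, η), (u', ¬η), (w, η'), (w', ¬η')]` with `u' = ±u`, `w' = ±w`.  This is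
Y. Matsumoto, *Torus fibrations over the 2-sphere with the simplest singular fibers*, J. Math. Soc.
Japan 37 (1985) 605–636, Thm. 3.2 (proof pp. 613–620 via Livne's theorem and Moishezon's normal
form in `PSL(2,ℤ)`), for `ν = 4` conjugates of `X^{±1}` with product `I`: the normal form
`(W₁, W₁⁻¹, W₂, W₂⁻¹)`.

**Why `u' = ±u` and not `u' = u`.**  The letters of the tree's words carry ORIENTED classes while
`T_{(−v,ε)} = T_{(v,ε)}`; the registered form with `u' = u`, `w' = w` is false: the word
`[(e₁,+), (−e₁,+), (e₁,−), (e₁,−)]` has primitive classes and trivial monodromy, all its pairings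
vanish, so every Hurwitz move is a transposition and its orbit is its set of `12` permutations,
none of the form `[(u,η),(u,¬η),(w,η'),(w,¬η')]`.  (Even with `|ω(u,w)| = 2` the word
`[(e₁,+),(−e₁,−),((1,2),+),((1,2),−)]` is not equivalent to an exactly-signed normal form — its
orbit reduced mod `4` has `192` elements and contains none; when `|ω(u,w)| = 1` three moves fix the
signs.)

**Proof (a descent, not Matsumoto's free-product argument).**  Induction on the complexity
`S4 = Σ_{i<j} |ω(vᵢ, vⱼ)|` (parts I–IV): unless some cyclically adjacent pair of opposite signs has
vanishing pairing, one of the six signed Hurwitz moves strictly decreases `S4`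
(`helper_descent_step`, a Vieta-jumping computation with the identities implied by
`T₁ T₂ = T₄⁻¹ T₃⁻¹`); a terminal word is `[(u,η),(±u,¬η),(w,η'),(±w,¬η')]` after at most two more
moves (`Matsumoto.nf_of_pair12`, `Matsumoto.nf_of_pair23`), since cancelling primitive letters
have equal classes up to sign (`Matsumoto.cancel_letters`).  The hypothesis "two letters of each
sign" is how the line uses the stub (`P ++ N`, `|P| = |N| = 2`); with three letters of one sign
trivial monodromy is impossible by the same identities, with four by abelianisation
`SL(2,ℤ) → ℤ/12` (not formalised here).

Everything is proved from Mathlib and the `SignedHurwitz` files; axioms: Lean's three only.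
-/

set_option linter.dupNamespace false

namespace Summit.SmoothPoincare4.SmoothPoincare4.Theorems.AcyclicBisectionRigidity.FoldedCurveBranchLocus

open Literature.GroupTheory.CombinatorialGroupTheory.SignedHurwitz

namespace Matsumoto

/-! ## Terminal words: an adjacent cancelling pair -/

/-- `ω(u, T_u z) = ω(u, z)`. [folklore] -/
theorem om_transvection_self (u z : Fin 1 ⊕ Fin 1 → ℤ) (s : Bool) :
    (stdSymp ℤ 1) u (transvection (stdSymp ℤ 1) (u, s) z) = (stdSymp ℤ 1) u z := by
  rw [transvection_apply, map_add, map_smul, stdSymp_int_self, smul_zero, add_zero]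

/-- `T_u^{ε} T_u^{ε} y = y + 2 ε ω(u,y) u`. [folklore] -/
theorem transvection_twice (u y : Fin 1 ⊕ Fin 1 → ℤ) (s : Bool) :
    transvection (stdSymp ℤ 1) (u, s) (transvection (stdSymp ℤ 1) (u, s) y) =
        y + (2 * sgn s * (stdSymp ℤ 1) u y) • u := by
  simp only [transvection_apply, map_add, map_smul, stdSymp_int_self, mul_zero]
  module

/-- **Cancelling letters.**  If the transvections of two primitive letters cancel, the letters have
the same class up to sign and opposite signs. [folklore] -/
theorem cancel_letters {u w : Fin 1 ⊕ Fin 1 → ℤ} {su sw : Bool}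
    (h : transvection (stdSymp ℤ 1) (u, su) * transvection (stdSymp ℤ 1) (w, sw) =
        1) (hu : IsPrimitive u) (hw : IsPrimitive w) :
    (w = u ∨ w = -u) ∧ sw = !su := by
  have huw : (stdSymp ℤ 1) u w = 0 := by
    obtain ⟨y, hy⟩ := exists_om_ne_zero (IsPrimitive.ne_zero' hw)
    have h1 := congrArg ((stdSymp ℤ 1) u) (LinearMap.congr_fun h y)
    simp only [Module.End.mul_apply, Module.End.one_apply, om_transvection_self] at h1
    rw [transvection_apply, map_add, map_smul, smul_eq_mul] at h1
    have h2 : sgn sw * (stdSymp ℤ 1) w y * (stdSymp ℤ 1) u w = 0 := by linear_combination h1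
    rcases mul_eq_zero.mp h2 with h3 | h3
    · rcases mul_eq_zero.mp h3 with h4 | h4
      · rcases sgn_eq_or sw with h5 | h5 <;> simp [h5] at h4
      · exact absurd h4 hy
    · exact h3
  have hwu := eq_or_eq_neg_of_om_eq_zero hu hw huw
  refine ⟨hwu, ?_⟩
  have h' : transvection (stdSymp ℤ 1) (u, su) * transvection (stdSymp ℤ 1) (u, sw) = 1 := by
    rcases hwu with rfl | rfl
    · exact h
    · rwa [transvection_neg_fst] at h
  by_contra hne
  have hsw : sw = su := by cases su <;> cases sw <;> simp_all
  subst hsw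
  obtain ⟨y, hy⟩ := exists_om_ne_zero (IsPrimitive.ne_zero' hu)
  have h1 := LinearMap.congr_fun h' y
  simp only [Module.End.mul_apply, Module.End.one_apply, transvection_twice] at h1
  have h2 : (2 * sgn sw * (stdSymp ℤ 1) u y) • u = 0 := by simpa using h1
  rcases smul_eq_zero.mp h2 with h3 | h3
  · exact hy ((mul_eq_zero.mp h3).resolve_left (by rcases sgn_eq_or sw with h5 | h5 <;> simp [h5]))
  · exact IsPrimitive.ne_zero' hu h3

/-- Two parallel primitive letters of opposite signs cancel. [folklore] -/
theorem cancel_of_parallel {u w : Fin 1 ⊕ Fin 1 → ℤ} {su sw : Bool} (h0 : (stdSymp ℤ 1) u w =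
    0) (hs : su ≠ sw)
    (hu : IsPrimitive u) (hw : IsPrimitive w) :
    transvection (stdSymp ℤ 1) (u, su) * transvection (stdSymp ℤ 1) (w, sw) = 1 := by
  have hsw : sw = !su := by cases su <;> cases sw <;> simp_all
  subst hsw
  rcases eq_or_eq_neg_of_om_eq_zero hu hw h0 with rfl | rfl
  · exact tv_mul_tv_not _ su
  · rw [transvection_neg_fst]; exact tv_mul_tv_not u su

section FourLetters

variable {v₁ v₂ v₃ v₄ : Fin 1 ⊕ Fin 1 → ℤ} {b₁ b₂ b₃ b₄ : Bool}

/-- In a product-one word, `T₁ T₂ = 1` forces `T₃ T₄ = 1`. [folklore] -/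
theorem pair34_of_pair12 (h : wordProduct (stdSymp ℤ 1) [(v₁, b₁), (v₂, b₂), (v₃, b₃), (v₄, b₄)] =
    1)
    (h12 : transvection (stdSymp ℤ 1) (v₁, b₁) * transvection (stdSymp ℤ 1) (v₂, b₂) = 1) :
    transvection (stdSymp ℤ 1) (v₃, b₃) * transvection (stdSymp ℤ 1) (v₄, b₄) = 1 := by
  rw [wordProduct_four] at h
  calc transvection (stdSymp ℤ 1) (v₃, b₃) * transvection (stdSymp ℤ 1) (v₄, b₄)
      = transvection (stdSymp ℤ 1) (v₁, b₁) * transvection (stdSymp ℤ 1) (v₂, b₂) *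
          (transvection (stdSymp ℤ 1) (v₃, b₃) * transvection (stdSymp ℤ 1) (v₄, b₄)) :=
              by rw [h12, one_mul]
    _ = 1 := by simpa only [mul_assoc] using h

/-- In a product-one word, `T₃ T₄ = 1` forces `T₁ T₂ = 1`. [folklore] -/
theorem pair12_of_pair34 (h : wordProduct (stdSymp ℤ 1) [(v₁, b₁), (v₂, b₂), (v₃, b₃), (v₄, b₄)] =
    1)
    (h34 : transvection (stdSymp ℤ 1) (v₃, b₃) * transvection (stdSymp ℤ 1) (v₄, b₄) = 1) :
    transvection (stdSymp ℤ 1) (v₁, b₁) * transvection (stdSymp ℤ 1) (v₂, b₂) = 1 := by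
  rw [wordProduct_four, h34, mul_one] at h
  exact h

/-- In a product-one word, `T₂ T₃ = 1` forces `T₁ T₄ = 1`. [folklore] -/
theorem pair14_of_pair23 (h : wordProduct (stdSymp ℤ 1) [(v₁, b₁), (v₂, b₂), (v₃, b₃), (v₄, b₄)] =
    1)
    (h23 : transvection (stdSymp ℤ 1) (v₂, b₂) * transvection (stdSymp ℤ 1) (v₃, b₃) = 1) :
    transvection (stdSymp ℤ 1) (v₁, b₁) * transvection (stdSymp ℤ 1) (v₄, b₄) = 1 := by
  rw [wordProduct_four] at h
  calc transvection (stdSymp ℤ 1) (v₁, b₁) * transvection (stdSymp ℤ 1) (v₄, b₄)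
      = transvection (stdSymp ℤ 1) (v₁, b₁) * (transvection (stdSymp ℤ 1) (v₂, b₂) *
          transvection (stdSymp ℤ 1) (v₃, b₃) *
          transvection (stdSymp ℤ 1) (v₄, b₄)) := by rw [h23, one_mul]
    _ = 1 := by simpa only [mul_assoc] using h

/-- In a product-one word, a cancelling pair in positions `4, 1` forces `T₂ T₃ = 1`. [folklore] -/
theorem pair23_of_pair41 (h : wordProduct (stdSymp ℤ 1) [(v₁, b₁), (v₂, b₂), (v₃, b₃), (v₄, b₄)] =
    1)
    (h14 : (stdSymp ℤ 1) v₁ v₄ = 0) (hb : b₁ ≠ b₄) (hp₁ : IsPrimitive v₁) (hp₄ : IsPrimitive v₄) :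
    transvection (stdSymp ℤ 1) (v₂, b₂) * transvection (stdSymp ℤ 1) (v₃, b₃) = 1 := by
  have hb' : b₄ = !b₁ := by cases b₁ <;> cases b₄ <;> simp_all
  have hT4 : transvection (stdSymp ℤ 1) (v₄, b₄) = transvection (stdSymp ℤ 1) (v₁, !b₁) := by
    rcases eq_or_eq_neg_of_om_eq_zero hp₁ hp₄ h14 with h4 | h4 <;> rw [h4, hb']
    exact transvection_neg_fst v₁ (!b₁)
  rw [wordProduct_four, hT4] at h
  have h1 := tv_not_mul_tv v₁ b₁
  calc transvection (stdSymp ℤ 1) (v₂, b₂) * transvection (stdSymp ℤ 1) (v₃, b₃)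
      = transvection (stdSymp ℤ 1) (v₁, !b₁) * transvection (stdSymp ℤ 1) (v₁, b₁) *
          (transvection (stdSymp ℤ 1) (v₂, b₂) * transvection (stdSymp ℤ 1) (v₃, b₃)) *
          (transvection (stdSymp ℤ 1) (v₁, !b₁) * transvection (stdSymp ℤ 1) (v₁, b₁)) :=
              by rw [h1, one_mul, mul_one]
    _ = transvection (stdSymp ℤ 1) (v₁, !b₁) * (transvection (stdSymp ℤ 1) (v₁, b₁) *
        (transvection (stdSymp ℤ 1) (v₂, b₂) *
          (transvection (stdSymp ℤ 1) (v₃, b₃) * transvection (stdSymp ℤ 1) (v₁, !b₁)))) *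
              transvection (stdSymp ℤ 1) (v₁, b₁) := by
        simp only [mul_assoc]
    _ = 1 := by rw [h, mul_one, h1]

/-- Normal form from a cancelling pair in positions `1, 2`. [folklore] -/
theorem nf_of_pair12 (h : wordProduct (stdSymp ℤ 1) [(v₁, b₁), (v₂, b₂), (v₃, b₃), (v₄, b₄)] = 1)
    (hp₁ : IsPrimitive v₁) (hp₂ : IsPrimitive v₂) (hp₃ : IsPrimitive v₃) (hp₄ : IsPrimitive v₄)
    (h12 : transvection (stdSymp ℤ 1) (v₁, b₁) * transvection (stdSymp ℤ 1) (v₂, b₂) = 1) :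
    ∃ (u u' w w' : Fin 1 ⊕ Fin 1 → ℤ) (η η' : Bool), (u' = u ∨ u' = -u) ∧ (w' = w ∨ w' = -w) ∧
      HurwitzOrbit (stdSymp ℤ 1) [(v₁, b₁), (v₂, b₂), (v₃, b₃), (v₄, b₄)] [(u, η), (u', !η), (w,
          η'), (w', !η')] := by
  obtain ⟨hv2, hb2⟩ := cancel_letters h12 hp₁ hp₂
  obtain ⟨hv4, hb4⟩ := cancel_letters (pair34_of_pair12 h h12) hp₃ hp₄
  refine ⟨v₁, v₂, v₃, v₄, b₁, b₃, hv2, hv4, ?_⟩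
  rw [← hb2, ← hb4]
  exact HurwitzOrbit.refl _ _

/-- Normal form from a cancelling pair in positions `2, 3` (two Hurwitz moves). [folklore] -/
theorem nf_of_pair23 (h : wordProduct (stdSymp ℤ 1) [(v₁, b₁), (v₂, b₂), (v₃, b₃), (v₄, b₄)] = 1)
    (hp₁ : IsPrimitive v₁) (hp₂ : IsPrimitive v₂) (hp₃ : IsPrimitive v₃) (hp₄ : IsPrimitive v₄)
    (h23 : transvection (stdSymp ℤ 1) (v₂, b₂) * transvection (stdSymp ℤ 1) (v₃, b₃) = 1) :
    ∃ (u u' w w' : Fin 1 ⊕ Fin 1 → ℤ) (η η' : Bool), (u' = u ∨ u' = -u) ∧ (w' = w ∨ w' = -w) ∧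
      HurwitzOrbit (stdSymp ℤ 1) [(v₁, b₁), (v₂, b₂), (v₃, b₃), (v₄, b₄)] [(u, η), (u', !η), (w,
          η'), (w', !η')] := by
  obtain ⟨hv3, hb3⟩ := cancel_letters h23 hp₂ hp₃
  obtain ⟨hv4, hb4⟩ := cancel_letters (pair14_of_pair23 h h23) hp₁ hp₄
  refine ⟨v₂ + (sgn b₁ * (stdSymp ℤ 1) v₁ v₂) • v₁, v₃ +
      (sgn b₁ * (stdSymp ℤ 1) v₁ v₃) • v₁, v₁, v₄, b₂, b₁, ?_, hv4, ?_⟩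
  · rcases hv3 with rfl | rfl
    · exact Or.inl rfl
    · right
      simp only [map_neg, mul_neg, neg_smul]
      abel
  · rw [← hb3, ← hb4]
    exact (HurwitzStep.orbit ⟨[], [(v₃, b₃), (v₄, b₄)], (v₁, b₁), (v₂, b₂), rfl, Or.inl rfl⟩).trans
      (HurwitzStep.orbit
        ⟨[(v₂ + (sgn b₁ *
            (stdSymp ℤ 1) v₁ v₂) • v₁, b₂)], [(v₄, b₄)], (v₁, b₁), (v₃, b₃), rfl, Or.inl rfl⟩)

end FourLetters

/-! ## The descent -/

/-- **Matsumoto's normal form by descent on the complexity** (four letters, two of each sign,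
primitive classes, trivial monodromy). [cite: Matsumoto1985, Thm. 3.2] -/
theorem normalForm_aux (n : ℕ) :
    ∀ (v₁ v₂ v₃ v₄ : Fin 1 ⊕ Fin 1 → ℤ) (b₁ b₂ b₃ b₄ : Bool), S4 v₁ v₂ v₃ v₄ ≤ n →
      wordProduct (stdSymp ℤ 1) [(v₁, b₁), (v₂, b₂), (v₃, b₃), (v₄, b₄)] = 1 →
      (sgn b₁ : ℤ) + sgn b₂ + sgn b₃ + sgn b₄ = 0 →
      IsPrimitive v₁ → IsPrimitive v₂ → IsPrimitive v₃ → IsPrimitive v₄ →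
      ∃ (u u' w w' : Fin 1 ⊕ Fin 1 → ℤ) (η η' : Bool), (u' = u ∨ u' = -u) ∧ (w' = w ∨ w' = -w) ∧
        HurwitzOrbit (stdSymp ℤ 1) [(v₁, b₁), (v₂, b₂), (v₃, b₃), (v₄, b₄)] [(u, η), (u', !η), (w,
            η'), (w', !η')] := by
  induction n using Nat.strong_induction_on with
  | _ n ih =>
  intro v₁ v₂ v₃ v₄ b₁ b₂ b₃ b₄ hS h h22 hp₁ hp₂ hp₃ hp₄
  by_cases hterm : ((stdSymp ℤ 1) v₁ v₂ = 0 ∧ b₁ ≠ b₂) ∨ ((stdSymp ℤ 1) v₂ v₃ =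
      0 ∧ b₂ ≠ b₃) ∨ ((stdSymp ℤ 1) v₃ v₄ = 0 ∧ b₃ ≠ b₄) ∨
      ((stdSymp ℤ 1) v₁ v₄ = 0 ∧ b₁ ≠ b₄)
  · rcases hterm with ⟨h0, hb⟩ | ⟨h0, hb⟩ | ⟨h0, hb⟩ | ⟨h0, hb⟩
    · exact nf_of_pair12 h hp₁ hp₂ hp₃ hp₄ (cancel_of_parallel h0 hb hp₁ hp₂)
    · exact nf_of_pair23 h hp₁ hp₂ hp₃ hp₄ (cancel_of_parallel h0 hb hp₂ hp₃)
    · exact nf_of_pair12 h hp₁ hp₂ hp₃ hp₄ (pair12_of_pair34 h (cancel_of_parallel h0 hb hp₃ hp₄))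
    · exact nf_of_pair23 h hp₁ hp₂ hp₃ hp₄ (pair23_of_pair41 h h0 hb hp₁ hp₄)
  · have hna : b₁ ≠ b₂ → (stdSymp ℤ 1) v₁ v₂ ≠ 0 := fun hb h0 => hterm (Or.inl ⟨h0, hb⟩)
    have hnd : b₂ ≠ b₃ → (stdSymp ℤ 1) v₂ v₃ ≠ 0 := fun hb h0 => hterm (Or.inr (Or.inl ⟨h0, hb⟩))
    have hnc : b₁ ≠ b₄ → (stdSymp ℤ 1) v₁ v₄ ≠ 0 :=
        fun hb h0 => hterm (Or.inr (Or.inr (Or.inr ⟨h0, hb⟩)))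
    obtain ⟨w₁, w₂, w₃, w₄, c₁, c₂, c₃, c₄, hstep, hlt, hc22⟩ :=
      helper_descent_step v₁ v₂ v₃ v₄ b₁ b₂ b₃ b₄ h h22 hna hnd hnc
    change S4 w₁ w₂ w₃ w₄ < S4 v₁ v₂ v₃ v₄ at hlt
    have h' : wordProduct (stdSymp ℤ 1) [(w₁, c₁), (w₂, c₂), (w₃, c₃), (w₄, c₄)] = 1 :=
      (wordProduct_eq_of_hurwitzStep hstep).trans h
    have hprim := isPrimitive_of_hurwitzStep hstep (by
      intro x hx
      simp only [List.mem_cons, List.not_mem_nil, or_false] at hx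
      rcases hx with rfl | rfl | rfl | rfl <;> assumption)
    have h0 := S4_nonneg w₁ w₂ w₃ w₄
    obtain ⟨u, u', w, w', η, η', hu, hw, horb⟩ := ih (S4 w₁ w₂ w₃ w₄).toNat (by omega) w₁ w₂ w₃ w₄
      c₁ c₂ c₃ c₄ (by omega) h' hc22 (hprim (w₁, c₁) (by simp)) (hprim (w₂, c₂) (by simp))
      (hprim (w₃, c₃) (by simp)) (hprim (w₄, c₄) (by simp))
    exact ⟨u, u', w, w', η, η', hu, hw, hstep.orbit.trans horb⟩

/-- The number of positive letters of a four-letter word, via `sgn`. [folklore] -/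
theorem sgn_sum_of_filter (x₁ x₂ x₃ x₄ : (Fin 1 ⊕ Fin 1 → ℤ) × Bool)
    (h : ([x₁, x₂, x₃, x₄].filter (·.2)).length = 2) :
    (sgn x₁.2 : ℤ) + sgn x₂.2 + sgn x₃.2 + sgn x₄.2 = 0 := by
  obtain ⟨v₁, b₁⟩ := x₁; obtain ⟨v₂, b₂⟩ := x₂; obtain ⟨v₃, b₃⟩ := x₃; obtain ⟨v₄, b₄⟩ := x₄
  cases b₁ <;> cases b₂ <;> cases b₃ <;> cases b₄ <;> simp at h ⊢

end Matsumoto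

/-- **Matsumoto's normal form for four-letter genus-one words (signs of classes free).**
A four-letter integral signed word at genus one with two letters of each sign, primitive classes and
trivial signed monodromy lies in the signed Hurwitz orbit of a word
`[(u, η), (u', ¬η), (w, η'), (w', ¬η')]` with `u' = ±u`, `w' = ±w` — Y. Matsumoto, J. Math. Soc. Japan
37 (1985), Thm. 3.2 for `ν = 4`, proved here by a Vieta-jumping descent on `Σ_{i<j} |ω(vᵢ, vⱼ)|`.
(The classes `u'`, `w'` cannot be normalised to `u`, `w` in general: the word
`[(e₁,+),(−e₁,+),(e₁,−),(e₁,−)]` has trivial monodromy and its orbit is its set of permutations.)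
[cite: Matsumoto1985, Thm. 3.2] -/
theorem helper_matsumotoNormalForm_pm :
    ∀ (l : IntWord 1), l.length = 4 → (l.filter (·.2)).length = 2 → (∀ x ∈ l, IsPrimitive x.1) →
      wordProduct (stdSymp ℤ 1) l = 1 →
      ∃ (u u' w w' : Fin 1 ⊕ Fin 1 → ℤ) (η η' : Bool), (u' = u ∨ u' = -u) ∧ (w' = w ∨ w' = -w) ∧
        HurwitzOrbit (stdSymp ℤ 1) l [(u, η), (u', !η), (w, η'), (w', !η')] := by
  intro l hlen hfil hprim hprod
  match l, hlen with
  | [x₁, x₂, x₃, x₄], _ =>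
    have h22 := Matsumoto.sgn_sum_of_filter x₁ x₂ x₃ x₄ hfil
    exact Matsumoto.normalForm_aux _ x₁.1 x₂.1 x₃.1 x₄.1 x₁.2 x₂.2 x₃.2 x₄.2 (Int.self_le_toNat _)
        hprod h22
      (hprim x₁ (by simp)) (hprim x₂ (by simp)) (hprim x₃ (by simp)) (hprim x₄ (by simp))

end Summit.SmoothPoincare4.SmoothPoincare4.Theorems.AcyclicBisectionRigidity.FoldedCurveBranchLocus
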